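import Mathlib
import Literature.NumberTheory.Automorphic.ResGLnCohomology
import Literature.NumberTheory.Automorphic.FinitelyManyComponentsGLn
import Literature.NumberTheory.Automorphic.GLnCuspidalSpectrumSiegel
import HarnessLib

/-!
# Finitely many `GL_n(K)⁺`-orbits on `GL_n(𝔸_K^∞) ⧸ K_f(𝔫)` (stub `stub_orbitCover` of line `Sketch`)

Crux `HeckeEigenvalueField` (stmt-Langlands-13632). For a number field `K`, a nonzero ideal
`𝔫 ⊆ 𝓞 K` and `GL_n(K)⁺ = ResGLnCohomology.glTotPos n K` of finite index in `GL_n(K)`, the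
`GL_n(K)⁺`-orbits (through the diagonal embedding `ResGLnCohomology.diagPos`) on the coset space
`GL_n(𝔸_K^∞) ⧸ K_f(𝔫)` (`K_f(𝔫) = ResGLnCohomology.level n K 𝔫`, the finite part of the principal
congruence subgroup, open for `𝔫 ≠ 0` by `isOpen_finitePrincipalCongruenceLevel`) are met by a
finite set of cosets.  This is the covering hypothesis of the Shapiro decomposition
`TwistedQuotient.moduleFinite_cohomology_of_finite_cover` for the cohomology of `Res_{K/ℚ} GL_n`.

Proof: the tree's `BigHeckeGLn.exists_finset_orbit_cover` (finiteness of the class number of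
`GL_n`, all `n`) gives a finite set `s₀` of cosets meeting every `GL_n(K)`-orbit; with `R` a (finite)
set of representatives of `GL_n(K) ⧸ GL_n(K)⁺`, the finite set `{r⁻¹ • x | x ∈ s₀, r ∈ R}` meets
every `GL_n(K)⁺`-orbit, since `γ • x = g • (r⁻¹ • x)` when `γ⁻¹ = r g⁻¹` with `g ∈ GL_n(K)⁺`.
[cite: BorelIHES1963, Thm. 5.1]
-/

set_option linter.dupNamespace false -- project-wide: Summit.Langlands.Langlands is the mandated namespace

noncomputable section

open scoped Classical
open NumberField IsDedekindDomain
open Literature.NumberTheory.Automorphic ResGLnCohomology BigHeckeGLn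

namespace Summit.Langlands.Langlands.Theorems.HeckeEigenvalueField.Res

/-- **Stub 2** — finitely many `GL_n(K)⁺`-orbits on `GL_n(𝔸_K^∞) ⧸ K_f(𝔫)` (`𝔫 ≠ 0`,
`[GL_n(K) : GL_n(K)⁺] < ∞`): the tree's `BigHeckeGLn.exists_finset_orbit_cover` (finitely many
`GL_n(K)`-orbits, i.e. finiteness of the class number of `GL_n`) refined along the finitely many
cosets of `GL_n(K)⁺` in `GL_n(K)` — if `s₀` meets every `GL_n(K)`-orbit and `R` is a set of
representatives of `GL_n(K) ⧸ GL_n(K)⁺`, then `{r⁻¹ • x | x ∈ s₀, r ∈ R}` meets every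
`GL_n(K)⁺`-orbit. [cite: BorelIHES1963, Thm. 5.1] -/
theorem stub_orbitCover :
    ∀ (n : ℕ) (K : Type) [Field K] [NumberField K] (𝔫 : Ideal (𝓞 K)), 𝔫 ≠ 0 →
      (glTotPos n K).FiniteIndex →
      ∃ s₀ : Finset (FiniteAdelicGL n K ⧸ level n K 𝔫), ∀ c : FiniteAdelicGL n K ⧸ level n K 𝔫,
        ∃ x ∈ s₀, ∃ γ : glTotPos n K, diagPos n K γ • x = c := by
  intro n K _ _ 𝔫 h𝔫 hfi
  obtain ⟨s₀, hcov⟩ :=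
    exists_finset_orbit_cover K (level n K 𝔫) (isOpen_finitePrincipalCongruenceLevel n K h𝔫)
  haveI : Finite (GL (Fin n) K ⧸ glTotPos n K) := Subgroup.finite_quotient_of_finiteIndex
  letI : Fintype (GL (Fin n) K ⧸ glTotPos n K) := Fintype.ofFinite _
  refine ⟨(s₀ ×ˢ (Finset.univ : Finset (GL (Fin n) K ⧸ glTotPos n K))).image fun p =>
      globalEmbedding n K (p.2.out)⁻¹ • p.1, fun c => ?_⟩
  obtain ⟨x, hx, γ, hγ⟩ := hcov c
  -- `(γ⁻¹ GL_n(K)⁺).out = γ⁻¹ * g` with `g ∈ GL_n(K)⁺`, so that `γ = g * ((γ⁻¹ GL_n(K)⁺).out)⁻¹`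
  obtain ⟨g, hg⟩ := QuotientGroup.mk_out_eq_mul (glTotPos n K) γ⁻¹
  refine ⟨globalEmbedding n K ((QuotientGroup.mk γ⁻¹ : GL (Fin n) K ⧸ glTotPos n K).out)⁻¹ • x,
    Finset.mem_image.2
      ⟨(x, (QuotientGroup.mk γ⁻¹ : GL (Fin n) K ⧸ glTotPos n K)),
        Finset.mk_mem_product hx (Finset.mem_univ _), rfl⟩,
    g, ?_⟩
  have h1 : (g : GL (Fin n) K) * (γ⁻¹ * (g : GL (Fin n) K))⁻¹ = γ := by group
  show globalEmbedding n K (g : GL (Fin n) K) •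
      globalEmbedding n K ((QuotientGroup.mk γ⁻¹ : GL (Fin n) K ⧸ glTotPos n K).out)⁻¹ • x = c
  rw [← mul_smul, ← map_mul, hg, h1]
  exact hγ

end Summit.Langlands.Langlands.Theorems.HeckeEigenvalueField.Res

end
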